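import Mathlib.Analysis.Convex.Integral
import Mathlib.Analysis.Normed.Ring.Units
import Mathlib.Topology.ContinuousMap.Compact
import Mathlib.Topology.ContinuousMap.Polynomial
import Literature.Analysis.Complex.GridCauchyFormula
import HarnessLib

/-!
# Runge's theorem, polynomial form (Conway VIII.1)

Let `K ⊆ ℂ` be compact with `ℂ \ K` connected. Then every function holomorphic on a
neighbourhood of `K` is a uniform limit on `K` of polynomials (Runge's theorem with all poles at
`∞`; Conway, *Functions of One Complex Variable I* (1978), Ch. VIII, Thm. 1.7 with
`E = {∞}`, via Prop. 1.1, Lemma 1.5 and Lemma 1.10; W. Rudin, *Real and Complex Analysis*, 3rd ed.,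
Thms. 13.6–13.9).

We follow Conway's proof, phrased in the Banach algebra `C(K, ℂ)`: let `A` be the closure of
the polynomial functions in `C(K, ℂ)`.

* (`Complex.inverse_one_sub_mem`) A closed subalgebra of a complete normed algebra is closed under
  `t ↦ (1 - t)⁻¹ = ∑ tⁿ` for `‖t‖ < 1` (geometric series).
* (`Complex.cauchyKernel_mem_of_norm_sub_lt`, the key step (1.11) of Conway's Lemma VIII.1.10) If the
  Cauchy kernel `k_{w₀} : z ↦ (w₀ - z)⁻¹` lies in a closed subalgebra `A ⊆ C(K, ℂ)` and
  `|w - w₀| < dist(w₀, K)`, then `k_w ∈ A`, because `k_w = k_{w₀} (1 - (w₀ - w) k_{w₀})⁻¹`.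
* (`Complex.cauchyKernel_mem_polynomialFunctions_topologicalClosure`, "pole pushing", Conway
  Lemma VIII.1.10 with `E = {∞}`) Hence the set of `w ∉ K` with `k_w ∈ A` is open and closed in `ℂ \ K`;
  it contains every `w` with `|w| > max_K |z|` (geometric series in `z/w`), so by connectedness
  of `ℂ \ K` it is all of `ℂ \ K`.
* (`Complex.intervalIntegral_mem_of_cauchyKernel_mem`, Conway Lemma VIII.1.5) A line integral
  `z ↦ ∫ₐᵇ φ(x) / (γ(x) - z) dx` over a path `γ` avoiding `K` lies in `A` as soon as all the
  kernels `k_{γ(x)}` do: it is the Bochner integral in `C(K, ℂ)` of the continuous `A`-valued map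
  `x ↦ φ(x) k_{γ(x)}`, and closed subspaces are stable under averaging
  (`Convex.set_average_mem`).
* (`Complex.exists_polynomial_norm_sub_lt`, **Runge's theorem**) By Cauchy's formula over a grid
  cycle in `Ω \ K` (`Complex.exists_grid_cauchy_formula`, Conway VIII.1.1), `f|_K` is a finite
  combination of such line integrals, hence lies in `A`.

## Main results

* `Complex.cauchyKernel`: the Cauchy kernel `z ↦ (w - z)⁻¹` on `K` (`w ∉ K`) as an element of
  `C(K, ℂ)`.
* `Complex.cauchyKernel_mem_polynomialFunctions_topologicalClosure`: pole pushing to `∞`.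
* `Complex.restrict_mem_polynomialFunctions_topologicalClosure`: for `K` compact with `ℂ \ K`
  connected and `f` holomorphic near `K`, `f|_K` lies in the closure of the polynomial functions.
* `Complex.exists_polynomial_norm_sub_lt`: **Runge's theorem**, `ε`-form.

## Mathlib

We USE `polynomialFunctions K : Subalgebra ℂ C(K, ℂ)` and `Subalgebra.topologicalClosure`,
the sup-norm Banach algebra structure on `C(K, ℂ)` (`Mathlib.Topology.ContinuousMap.Compact`),
the geometric series `geom_series_eq_inverse` / `mul_neg_geom_series` in complete normed rings,
`tsum_mem` (closed submonoids are closed under `∑'`), `Convex.set_average_mem` and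
`ContinuousMap.integral_apply` (Bochner integrals in `C(K, ℂ)`), and
`IsPreconnected.subset_of_closure_inter_subset` (the clopen argument). Mathlib has no form of
Runge's theorem as of this tree.

## References

* J. B. Conway, *Functions of One Complex Variable I*, 2nd ed., GTM 11, Springer (1978),
  Ch. VIII §1: Prop. 1.1, Lemma 1.5, Thm. 1.7, Lemmas 1.8 and 1.10 (with (1.11)–(1.13)),
  Cor. 1.14–1.15 (pp. 195–200).
* W. Rudin, *Real and Complex Analysis*, 3rd ed., McGraw-Hill (1987), Thms. 13.6–13.9.
-/

noncomputable section

open Set Filter Topology MeasureTheory Metric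

namespace Complex

/-! ### Geometric series in a closed subalgebra -/

/-- A closed subalgebra `A` of a complete normed algebra is closed under `t ↦ (1 - t)⁻¹` for
`‖t‖ < 1`: indeed `(1 - t)⁻¹ = ∑ₙ tⁿ` (`geom_series_eq_inverse`) and each partial sum lies in `A`.
Conway (1978), proof of Lemma VIII.1.10, (1.12)–(1.13). [cite: Conway1978, Ch. VIII Lemma 1.10] -/
theorem inverse_one_sub_mem {R : Type*} [NormedRing R] [CompleteSpace R] [NormedAlgebra ℂ R]
    {A : Subalgebra ℂ R} (hA : IsClosed (A : Set R)) {t : R} (ht : t ∈ A) (htn : ‖t‖ < 1) :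
    Ring.inverse (1 - t) ∈ A := by
  rw [← geom_series_eq_inverse t htn]
  exact tsum_mem hA fun n ↦ pow_mem ht n

/-! ### The Cauchy kernel in `C(K, ℂ)` -/

variable {K : Set ℂ}

/-- For `w ∉ K`, the **Cauchy kernel** `z ↦ (w - z)⁻¹` restricted to `K`, as an element of
`C(K, ℂ)`. Conway (1978), Ch. VIII §1 (proof of Thm. 1.7, p. 198). [cite: Conway1978, Ch. VIII §1] -/
def cauchyKernel {w : ℂ} (hw : w ∉ K) : C(K, ℂ) where
  toFun z := (w - z)⁻¹
  continuous_toFun := by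
    refine Continuous.inv₀ (by fun_prop) fun z h ↦ hw ?_
    rw [sub_eq_zero] at h
    exact h ▸ z.2

/-- The Cauchy kernel acts as `z ↦ (w - z)⁻¹`. [folklore] -/
@[simp] theorem cauchyKernel_apply {w : ℂ} (hw : w ∉ K) (z : K) :
    cauchyKernel hw z = (w - (z : ℂ))⁻¹ := rfl

/-- On the empty set every Cauchy kernel is `0` (`C(∅, ℂ)` is trivial). [folklore] -/
theorem cauchyKernel_eq_zero_of_eq_empty (hK : K = ∅) {w : ℂ} (hw : w ∉ K) :
    cauchyKernel hw = 0 := by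
  subst hK
  exact ContinuousMap.ext fun z ↦ z.2.elim

/-- `ℝ`-convexity of (the carrier of) a `ℂ`-subalgebra of `C(K, ℂ)`, as needed by
`Convex.set_average_mem`. [folklore] -/
theorem convex_coe_subalgebra (A : Subalgebra ℂ C(K, ℂ)) : Convex ℝ (A : Set C(K, ℂ)) :=
  (A.toSubmodule.restrictScalars ℝ).convex

/-- Real scalar multiples stay in a `ℂ`-subalgebra of `C(K, ℂ)`. [folklore] -/
theorem real_smul_mem_subalgebra {A : Subalgebra ℂ C(K, ℂ)} {g : C(K, ℂ)} (hg : g ∈ A) (c : ℝ) :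
    c • g ∈ A := by
  rw [← algebraMap_smul ℂ c g]
  exact A.smul_mem hg _

/-- Pointwise inverse formula: if `u * s = 1` in `C(K, ℂ)` then `s z = (u z)⁻¹`. [folklore] -/
theorem apply_eq_inv_of_mul_eq_one {u s : C(K, ℂ)} (h : u * s = 1) (z : K) :
    s z = (u z)⁻¹ := by
  have hz : u z * s z = 1 := by
    have := congr_arg (fun g : C(K, ℂ) ↦ g z) h
    simpa using this
  have hu : u z ≠ 0 := fun h0 ↦ by simp [h0] at hz
  field_simp
  simpa [mul_comm] using hz

section CompactSpace

variable [CompactSpace K]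

/-- Sup-norm bound for the Cauchy kernel: `‖k_w‖ ≤ dist(w, K)⁻¹` when `dist(w, K) > 0`.
[folklore] -/
theorem norm_cauchyKernel_le {w : ℂ} (hw : w ∉ K) (hd : 0 < infDist w K) :
    ‖cauchyKernel hw‖ ≤ (infDist w K)⁻¹ := by
  refine (ContinuousMap.norm_le _ (inv_nonneg.2 hd.le)).2 fun z ↦ ?_
  rw [cauchyKernel_apply, norm_inv]
  refine inv_anti₀ hd ?_
  rw [← dist_eq_norm]
  exact infDist_le_dist_of_mem z.2

/-- **Moving the pole a little** (Conway VIII.1.10, statement (1.11)). Let `A` be a closed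
subalgebra of `C(K, ℂ)` containing the Cauchy kernel `k_{w₀}`, `w₀ ∉ K`. If `w ∉ K` and
`|w - w₀| < dist(w₀, K)` then `k_w ∈ A`: with `t := (w₀ - w) k_{w₀}` one has `‖t‖ < 1` and
`k_w = k_{w₀} · ∑ₙ tⁿ = k_{w₀} (1 - t)⁻¹`, since `w - z = (w₀ - z)(1 - (w₀ - w)/(w₀ - z))`.
Conway (1978), Ch. VIII Lemma 1.10, (1.11)–(1.13). [cite: Conway1978, Ch. VIII Lemma 1.10 (1.11)] -/
theorem cauchyKernel_mem_of_norm_sub_lt {A : Subalgebra ℂ C(K, ℂ)}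
    (hA : IsClosed (A : Set C(K, ℂ))) {w₀ w : ℂ} (hw₀ : w₀ ∉ K) (hw : w ∉ K)
    (h₀ : cauchyKernel hw₀ ∈ A) (hlt : ‖w - w₀‖ < infDist w₀ K) : cauchyKernel hw ∈ A := by
  set k₀ : C(K, ℂ) := cauchyKernel hw₀ with hk₀
  set t : C(K, ℂ) := (w₀ - w) • k₀ with ht
  have hd : 0 < infDist w₀ K := (norm_nonneg _).trans_lt hlt
  have htn : ‖t‖ < 1 := by
    calc ‖t‖ ≤ ‖w₀ - w‖ * ‖k₀‖ := norm_smul_le _ _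
      _ ≤ ‖w - w₀‖ * (infDist w₀ K)⁻¹ := by
          rw [norm_sub_rev]
          exact mul_le_mul_of_nonneg_left (norm_cauchyKernel_le hw₀ hd) (norm_nonneg _)
      _ < 1 := by rwa [← div_eq_mul_inv, div_lt_one hd]
  have htA : t ∈ A := A.smul_mem h₀ _
  have hsA : (∑' n : ℕ, t ^ n) ∈ A := tsum_mem hA fun n ↦ pow_mem htA n
  have hmul : (1 - t) * ∑' n : ℕ, t ^ n = 1 := mul_neg_geom_series t htn
  convert A.mul_mem h₀ hsA using 1
  ext z
  have h1 : (w₀ : ℂ) - z ≠ 0 := sub_ne_zero.2 fun h ↦ hw₀ (h ▸ z.2)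
  have h2 : (w : ℂ) - z ≠ 0 := sub_ne_zero.2 fun h ↦ hw (h ▸ z.2)
  rw [ContinuousMap.mul_apply, apply_eq_inv_of_mul_eq_one hmul z, hk₀, cauchyKernel_apply,
    cauchyKernel_apply, ← mul_inv]
  congr 1
  simp only [ht, hk₀, ContinuousMap.sub_apply, ContinuousMap.one_apply, ContinuousMap.smul_apply,
    cauchyKernel_apply, smul_eq_mul]
  field_simp
  ring

/-- **Kernels with far-away poles are limits of polynomials.** If `|z| ≤ R` on `K` and `R < |w|`
then `k_w = w⁻¹ ∑ₙ (z/w)ⁿ` lies in the closure of the polynomial functions on `K`. Conway (1978),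
Ch. VIII, proof of Lemma 1.10, Case 2 (`∞ ∈ E`). [cite: Conway1978, Ch. VIII Lemma 1.10 (Case 2)] -/
theorem cauchyKernel_mem_of_lt_norm {R : ℝ} (hR₀ : 0 ≤ R) (hR : ∀ z ∈ K, ‖z‖ ≤ R) {w : ℂ}
    (hRw : R < ‖w‖) (hw : w ∉ K) :
    cauchyKernel hw ∈ (polynomialFunctions K).topologicalClosure := by
  set A := (polynomialFunctions K).topologicalClosure with hAdef
  have hA : IsClosed (A : Set C(K, ℂ)) := Subalgebra.isClosed_topologicalClosure _
  have hw0 : w ≠ 0 := norm_pos_iff.1 (hR₀.trans_lt hRw)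
  -- the coordinate function
  set Z : C(K, ℂ) := Polynomial.toContinuousMapOnAlgHom K Polynomial.X with hZ
  have hZA : Z ∈ A := (Subalgebra.le_topologicalClosure _) ⟨Polynomial.X, Algebra.mem_top, rfl⟩
  have hZapply : ∀ z : K, Z z = z := fun z ↦ by simp [hZ]
  have hZn : ‖Z‖ ≤ R := (ContinuousMap.norm_le _ hR₀).2 fun z ↦ by simpa [hZapply] using hR z z.2
  set t : C(K, ℂ) := w⁻¹ • Z with ht
  have htn : ‖t‖ < 1 := by
    calc ‖t‖ ≤ ‖w⁻¹‖ * ‖Z‖ := norm_smul_le _ _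
      _ ≤ ‖w‖⁻¹ * R := by rw [norm_inv]; gcongr
      _ < 1 := by
          rw [← div_eq_inv_mul, div_lt_one ((hR₀.trans_lt hRw))]
          exact hRw
  have htA : t ∈ A := A.smul_mem hZA _
  have hsA : (∑' n : ℕ, t ^ n) ∈ A := tsum_mem hA fun n ↦ pow_mem htA n
  have hmul : (1 - t) * ∑' n : ℕ, t ^ n = 1 := mul_neg_geom_series t htn
  convert A.smul_mem hsA w⁻¹ using 1
  ext z
  have h2 : (w : ℂ) - z ≠ 0 := sub_ne_zero.2 fun h ↦ hw (h ▸ z.2)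
  rw [ContinuousMap.smul_apply, apply_eq_inv_of_mul_eq_one hmul z, smul_eq_mul, cauchyKernel_apply,
    ← mul_inv]
  congr 1
  simp only [ht, ContinuousMap.sub_apply, ContinuousMap.one_apply, ContinuousMap.smul_apply,
    hZapply, smul_eq_mul]
  field_simp

/-- **Line integrals of the Cauchy kernel stay in a closed subalgebra** (Conway's Lemma VIII.1.5
in Banach-algebra form). Let `A ⊆ C(K, ℂ)` be a closed subalgebra, `γ, φ : [a, b] → ℂ` continuous
with `γ` avoiding `K` and `k_{γ(x)} ∈ A` for all `x ∈ [a, b]`. Then the function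
`z ↦ ∫ₐᵇ φ(x) / (γ(x) - z) dx` on `K` lies in `A`: it is `∫ₐᵇ F` for the continuous map
`F : x ↦ φ(x) k_{γ(x)}` into the Banach space `C(K, ℂ)` (`ContinuousMap.integral_apply`), and a
closed subspace contains the averages of maps with values in it (`Convex.set_average_mem`).
Conway (1978), Ch. VIII Lemma 1.5 (there via Riemann sums, eq. (1.6)). [cite: Conway1978, Ch. VIII Lemma 1.5] -/
theorem intervalIntegral_mem_of_cauchyKernel_mem {A : Subalgebra ℂ C(K, ℂ)}
    (hA : IsClosed (A : Set C(K, ℂ))) {a b : ℝ} (hab : a ≤ b) {γ φ : ℝ → ℂ}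
    (hγ : ContinuousOn γ (Icc a b)) (hφ : ContinuousOn φ (Icc a b))
    (hγK : ∀ x ∈ Icc a b, γ x ∉ K) (hmem : ∀ x (hx : x ∈ Icc a b), cauchyKernel (hγK x hx) ∈ A)
    {g : C(K, ℂ)} (hg : ∀ z : K, g z = ∫ x in a..b, φ x / (γ x - z)) : g ∈ A := by
  rcases hab.eq_or_lt with rfl | hab'
  · have : g = 0 := ContinuousMap.ext fun z ↦ by simp [hg]
    rw [this]
    exact zero_mem A
  -- clamp the parametrisations to `[a, b]`
  set γ' : ℝ → ℂ := IccExtend hab (fun x ↦ γ x) with hγ'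
  set φ' : ℝ → ℂ := IccExtend hab (fun x ↦ φ x) with hφ'
  have hγ'c : Continuous γ' := (continuous_IccExtend_iff).2 hγ.restrict
  have hφ'c : Continuous φ' := (continuous_IccExtend_iff).2 hφ.restrict
  have hγ'eq : EqOn γ' γ (Icc a b) := fun x hx ↦ IccExtend_of_mem hab _ hx
  have hφ'eq : EqOn φ' φ (Icc a b) := fun x hx ↦ IccExtend_of_mem hab _ hx
  have hγ'K : ∀ x, γ' x ∉ K := fun x ↦ hγK _ (projIcc a b hab x).2
  -- the integrand as a continuous map into `C(K, ℂ)` with values in `A`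
  set F : ℝ → C(K, ℂ) := fun x ↦ φ' x • cauchyKernel (hγ'K x) with hF
  have hFapply : ∀ x (z : K), F x z = φ' x * (γ' x - z)⁻¹ := fun x z ↦ by
    simp [hF]
  have hFc : Continuous F := by
    refine ContinuousMap.continuous_of_continuous_uncurry _ ?_
    have : (Function.uncurry fun x (z : K) ↦ F x z) =
        fun p : ℝ × K ↦ φ' p.1 * (γ' p.1 - (p.2 : ℂ))⁻¹ := by
      ext ⟨x, z⟩
      exact hFapply x z
    rw [this]
    refine (hφ'c.comp continuous_fst).mul (Continuous.inv₀ ?_ fun p ↦ ?_)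
    · exact (hγ'c.comp continuous_fst).sub (continuous_subtype_val.comp continuous_snd)
    · exact sub_ne_zero.2 fun h ↦ hγ'K p.1 (h ▸ p.2.2)
  have hFA : ∀ x, F x ∈ A := fun x ↦ A.smul_mem (hmem _ (projIcc a b hab x).2) _
  -- the Bochner integral of `F` over `(a, b]` lies in `A`
  have hint : IntegrableOn F (Ioc a b) := hFc.integrableOn_Ioc
  have hvol : volume (Ioc a b) ≠ 0 := by simp [Real.volume_Ioc, hab']
  have hvol' : volume (Ioc a b) ≠ ⊤ := measure_Ioc_lt_top.ne
  have havg : ⨍ x in Ioc a b, F x ∈ (A : Set C(K, ℂ)) :=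
    (convex_coe_subalgebra A).set_average_mem hA hvol hvol' (Eventually.of_forall fun x ↦ hFA x)
      hint
  rw [setAverage_eq] at havg
  have hreal : volume.real (Ioc a b) ≠ 0 := by
    simp [Measure.real, Real.volume_Ioc, hab'.le, sub_eq_zero, hab'.ne']
  have hI : ∫ x in Ioc a b, F x ∈ A := by
    have := real_smul_mem_subalgebra havg (volume.real (Ioc a b))
    rwa [smul_inv_smul₀ hreal] at this
  -- and it is `g`
  have hgI : g = ∫ x in Ioc a b, F x := by
    ext z
    rw [ContinuousMap.integral_apply hint, hg, intervalIntegral.integral_of_le hab]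
    refine setIntegral_congr_fun measurableSet_Ioc fun x hx ↦ ?_
    have hx' : x ∈ Icc a b := Ioc_subset_Icc_self hx
    rw [hFapply, hγ'eq hx', hφ'eq hx', div_eq_mul_inv]
  rw [hgI]
  exact hI

/-! ### Pole pushing (Conway VIII.1.10) -/

/-- **Pole pushing to `∞`** (Conway's Lemma VIII.1.10 with `E = {∞}`, the heart of Runge's
theorem). If
`K ⊆ ℂ` is compact and `ℂ \ K` is connected, then for every `w ∉ K` the Cauchy kernel
`z ↦ (w - z)⁻¹` is a uniform limit on `K` of polynomials. Proof: the set `S` of such `w` is open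
in `ℂ \ K` and relatively closed (`cauchyKernel_mem_of_norm_sub_lt`, twice), and contains all `w`
with `|w| > max_K |z|` (`cauchyKernel_mem_of_lt_norm`); connectedness of `ℂ \ K` gives
`S = ℂ \ K` (Conway argues via Lemma 1.9 on components instead). Conway, *Functions of One
Complex Variable I* (1978), Ch. VIII Lemma 1.10. [cite: Conway1978, Ch. VIII Lemma 1.10] -/
theorem cauchyKernel_mem_polynomialFunctions_topologicalClosure
    (hKc : IsPreconnected Kᶜ) {w : ℂ} (hw : w ∉ K) :
    cauchyKernel hw ∈ (polynomialFunctions K).topologicalClosure := by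
  have hK : IsCompact K := isCompact_iff_compactSpace.mpr ‹_›
  rcases K.eq_empty_or_nonempty with hKe | hKne
  · rw [cauchyKernel_eq_zero_of_eq_empty hKe]
    exact zero_mem _
  set A := (polynomialFunctions K).topologicalClosure with hAdef
  have hA : IsClosed (A : Set C(K, ℂ)) := Subalgebra.isClosed_topologicalClosure _
  have hd : ∀ {v : ℂ}, v ∉ K → 0 < infDist v K := fun hv ↦
    (hK.isClosed.notMem_iff_infDist_pos hKne).1 hv
  obtain ⟨R₀, hR₀⟩ := hK.isBounded.exists_norm_le
  set R : ℝ := max R₀ 0 with hRdef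
  have hR : ∀ z ∈ K, ‖z‖ ≤ R := fun z hz ↦ (hR₀ z hz).trans (le_max_left _ _)
  have hRnn : 0 ≤ R := le_max_right _ _
  -- the good set
  set S : Set ℂ := {v | ∃ hv : v ∉ K, cauchyKernel hv ∈ A} with hSdef
  suffices h : Kᶜ ⊆ S by
    obtain ⟨hw', h⟩ := h hw
    exact h
  have hstep : ∀ {v₀ v : ℂ}, v₀ ∈ S → dist v v₀ < infDist v₀ K → v ∈ S := by
    rintro v₀ v ⟨hv₀, h₀⟩ hlt
    have hv : v ∉ K := fun hvK ↦ by
      have := infDist_le_dist_of_mem (x := v₀) hvK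
      rw [dist_comm] at hlt
      linarith
    exact ⟨hv, cauchyKernel_mem_of_norm_sub_lt hA hv₀ hv h₀ (by rwa [← dist_eq_norm])⟩
  refine hKc.subset_of_closure_inter_subset (u := S) ?_ ?_ ?_
  · -- `S` is open
    refine Metric.isOpen_iff.2 ?_
    rintro v₀ hv₀S
    have hv₀ : v₀ ∉ K := hv₀S.1
    exact ⟨infDist v₀ K, hd hv₀, fun v hv ↦ hstep hv₀S hv⟩
  · -- far points are in `S`
    have hnorm : R < ‖((R + 1 : ℝ) : ℂ)‖ := by
      rw [norm_real, Real.norm_eq_abs, abs_of_nonneg (by linarith)]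
      linarith
    have hv : ((R + 1 : ℝ) : ℂ) ∉ K := fun h ↦ by linarith [hR _ h]
    exact ⟨_, hv, hv, cauchyKernel_mem_of_lt_norm hRnn hR hnorm hv⟩
  · -- `S` is relatively closed in `ℂ \ K`
    rintro v₀ ⟨hv₀c, hv₀⟩
    have hd₀ := hd hv₀
    obtain ⟨v, hvS, hdist⟩ := Metric.mem_closure_iff.1 hv₀c (infDist v₀ K / 2) (by positivity)
    refine hstep hvS ?_
    have := infDist_le_infDist_add_dist (s := K) (x := v₀) (y := v)
    have hsym : dist v₀ v = dist v v₀ := dist_comm _ _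
    linarith

/-! ### Runge's theorem -/

/-- **Runge's theorem, membership form.** Let `K ⊆ Ω ⊆ ℂ` with `K` compact, `Ω` open and
`ℂ \ K` connected, and let `f` be holomorphic on `Ω`. Then `f|_K` lies in the closure of the
polynomial functions in `C(K, ℂ)`. Proof: by Cauchy's formula over a grid cycle in `Ω \ K`
(`Complex.exists_grid_cauchy_formula`, Conway VIII.1.1), `f|_K` is a finite combination of line
integrals `z ↦ ∫ f(γ(x))/(γ(x) - z) dx` over segments avoiding `K`, each of which lies in the
closure (`intervalIntegral_mem_of_cauchyKernel_mem` and pole pushing). Conway, *Functions of One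
Complex Variable I* (1978), Ch. VIII Thm. 1.7 (with `E = {∞}`) and its proof, p. 199. [cite: Conway1978, Ch. VIII Thm. 1.7] -/
theorem restrict_mem_polynomialFunctions_topologicalClosure {Ω : Set ℂ} (hΩ : IsOpen Ω)
    (hKΩ : K ⊆ Ω) (hKc : IsPreconnected Kᶜ) {f : ℂ → ℂ}
    (hf : DifferentiableOn ℂ f Ω) (g : C(K, ℂ)) (hg : ∀ z : K, g z = f z) :
    g ∈ (polynomialFunctions K).topologicalClosure := by
  classical
  have hK : IsCompact K := isCompact_iff_compactSpace.mpr ‹_›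
  set A := (polynomialFunctions K).topologicalClosure with hAdef
  have hA : IsClosed (A : Set C(K, ℂ)) := Subalgebra.isClosed_topologicalClosure _
  have hfc : ContinuousOn f Ω := hf.continuousOn
  obtain ⟨δ, S, T, hδ, hH, hV, hformula⟩ := exists_grid_cauchy_formula hΩ hK hKΩ
  -- horizontal edge integrals, as elements of `A`
  have hHmem : ∀ q ∈ T, gridHCoeff S q ≠ 0 → ∃ Hq : C(K, ℂ), Hq ∈ A ∧
      ∀ z : K, Hq z = gridHIntegral δ q (fun w ↦ f w / (w - z)) := by
    intro q hq hc
    have hedge := hH q hq hc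
    have hab : (q.1 : ℝ) * δ ≤ (q.1 + 1) * δ := by nlinarith
    have hmem : ∀ x ∈ Icc ((q.1 : ℝ) * δ) ((q.1 + 1) * δ),
        (x : ℂ) + (((q.2 : ℝ) * δ : ℝ) : ℂ) * I ∈ gridHEdge δ q := fun x hx ↦
      ⟨by simpa using hx, by simp⟩
    have hγ : ContinuousOn (fun x : ℝ ↦ (x : ℂ) + (((q.2 : ℝ) * δ : ℝ) : ℂ) * I)
        (Icc ((q.1 : ℝ) * δ) ((q.1 + 1) * δ)) := by fun_prop
    have hφ : ContinuousOn (fun x : ℝ ↦ f ((x : ℂ) + (((q.2 : ℝ) * δ : ℝ) : ℂ) * I))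
        (Icc ((q.1 : ℝ) * δ) ((q.1 + 1) * δ)) :=
      hfc.comp hγ fun x hx ↦ (hedge (hmem x hx)).1
    have hγK : ∀ x ∈ Icc ((q.1 : ℝ) * δ) ((q.1 + 1) * δ),
        (x : ℂ) + (((q.2 : ℝ) * δ : ℝ) : ℂ) * I ∉ K := fun x hx ↦ (hedge (hmem x hx)).2
    have hcont : ContinuousOn
        (fun z : ℂ ↦ ∫ x in ((q.1 : ℝ) * δ)..((q.1 + 1 : ℝ) * δ),
          f ((x : ℂ) + (((q.2 : ℝ) * δ : ℝ) : ℂ) * I) / ((x : ℂ) + (((q.2 : ℝ) * δ : ℝ) : ℂ) * I - z)) K := by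
      refine (continuousOn_integral_div_sub hab hγ hφ).mono ?_
      refine subset_compl_comm.1 ?_
      rintro _ ⟨x, hx, rfl⟩
      exact hγK x hx
    refine ⟨⟨fun z ↦ gridHIntegral δ q (fun w ↦ f w / (w - z)), ?_⟩, ?_, fun z ↦ rfl⟩
    · exact hcont.restrict
    · exact intervalIntegral_mem_of_cauchyKernel_mem hA hab hγ hφ hγK
        (fun x hx ↦ cauchyKernel_mem_polynomialFunctions_topologicalClosure hKc _)
        (fun z ↦ rfl)
  -- vertical edge integrals, as elements of `A`
  have hVmem : ∀ q ∈ T, gridVCoeff S q ≠ 0 → ∃ Vq : C(K, ℂ), Vq ∈ A ∧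
      ∀ z : K, Vq z = gridVIntegral δ q (fun w ↦ f w / (w - z)) := by
    intro q hq hc
    have hedge := hV q hq hc
    have hab : (q.2 : ℝ) * δ ≤ (q.2 + 1) * δ := by nlinarith
    have hmem : ∀ y ∈ Icc ((q.2 : ℝ) * δ) ((q.2 + 1) * δ),
        ((((q.1 : ℝ) * δ : ℝ) : ℂ) + (y : ℂ) * I) ∈ gridVEdge δ q := fun y hy ↦
      ⟨by simp, by simpa using hy⟩
    have hγ : ContinuousOn (fun y : ℝ ↦ (((q.1 : ℝ) * δ : ℝ) : ℂ) + (y : ℂ) * I)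
        (Icc ((q.2 : ℝ) * δ) ((q.2 + 1) * δ)) := by fun_prop
    have hφ : ContinuousOn (fun y : ℝ ↦ f ((((q.1 : ℝ) * δ : ℝ) : ℂ) + (y : ℂ) * I))
        (Icc ((q.2 : ℝ) * δ) ((q.2 + 1) * δ)) :=
      hfc.comp hγ fun y hy ↦ (hedge (hmem y hy)).1
    have hγK : ∀ y ∈ Icc ((q.2 : ℝ) * δ) ((q.2 + 1) * δ),
        (((q.1 : ℝ) * δ : ℝ) : ℂ) + (y : ℂ) * I ∉ K := fun y hy ↦ (hedge (hmem y hy)).2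
    have hcont : ContinuousOn
        (fun z : ℂ ↦ ∫ y in ((q.2 : ℝ) * δ)..((q.2 + 1 : ℝ) * δ),
          f ((((q.1 : ℝ) * δ : ℝ) : ℂ) + (y : ℂ) * I) / ((((q.1 : ℝ) * δ : ℝ) : ℂ) + (y : ℂ) * I - z)) K := by
      refine (continuousOn_integral_div_sub hab hγ hφ).mono ?_
      refine subset_compl_comm.1 ?_
      rintro _ ⟨y, hy, rfl⟩
      exact hγK y hy
    refine ⟨⟨fun z ↦ gridVIntegral δ q (fun w ↦ f w / (w - z)), ?_⟩, ?_, fun z ↦ rfl⟩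
    · exact hcont.restrict
    · exact intervalIntegral_mem_of_cauchyKernel_mem hA hab hγ hφ hγK
        (fun y hy ↦ cauchyKernel_mem_polynomialFunctions_topologicalClosure hKc _)
        (fun z ↦ rfl)
  -- choose the elements
  choose! Hq hHqA hHq using hHmem
  choose! Vq hVqA hVq using hVmem
  -- `g` as a combination
  set G : C(K, ℂ) := (2 * Real.pi * I)⁻¹ •
    (∑ q ∈ T, (gridHCoeff S q : ℂ) • (if gridHCoeff S q = 0 then 0 else Hq q) +
      I • ∑ q ∈ T, (gridVCoeff S q : ℂ) • (if gridVCoeff S q = 0 then 0 else Vq q)) with hGdef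
  have hGA : G ∈ A := by
    refine A.smul_mem (A.add_mem (A.sum_mem fun q hq ↦ A.smul_mem ?_ _)
      (A.smul_mem (A.sum_mem fun q hq ↦ A.smul_mem ?_ _) _)) _
    · split_ifs with hc
      · exact zero_mem A
      · exact hHqA q hq hc
    · split_ifs with hc
      · exact zero_mem A
      · exact hVqA q hq hc
  have hπ : (2 * Real.pi * I : ℂ) ≠ 0 := by simp [Real.pi_ne_zero]
  have hgG : g = G := by
    ext z
    have hz := hformula f hf z z.2
    rw [hg]
    simp only [hGdef, ContinuousMap.smul_apply, ContinuousMap.add_apply, ContinuousMap.coe_sum,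
      Finset.sum_apply, smul_eq_mul]
    rw [eq_inv_mul_iff_mul_eq₀ hπ, ← hz]
    congr 1
    · refine Finset.sum_congr rfl fun q hq ↦ ?_
      by_cases hc : gridHCoeff S q = 0
      · simp [hc]
      · simp [hc, hHq q hq hc z]
    · congr 1
      refine Finset.sum_congr rfl fun q hq ↦ ?_
      by_cases hc : gridVCoeff S q = 0
      · simp [hc]
      · simp [hc, hVq q hq hc z]
  rw [hgG]
  exact hGA

end CompactSpace

/-- **Runge's theorem** (polynomial approximation on a compact set with connected complement;
Conway VIII.1.7 with `E = {∞}`: a rational function whose only pole is `∞` is a polynomial). Let `K ⊆ ℂ` be compact with `ℂ \ K` connected and let `f` be holomorphic on an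
open set `Ω ⊇ K`. Then for every `ε > 0` there is a polynomial `p` with `|f(z) - p(z)| < ε` for
all `z ∈ K`. (`ℂ \ K` connected iff `ℂ∞ \ K` connected, `K` being compact.) Conway,
*Functions of One Complex Variable I* (1978), Ch. VIII Thm. 1.7; Rudin, *Real and Complex
Analysis*, Thm. 13.7. [cite: Conway1978, Ch. VIII Thm. 1.7] -/
theorem exists_polynomial_norm_sub_lt {Ω : Set ℂ} (hΩ : IsOpen Ω) (hK : IsCompact K)
    (hKΩ : K ⊆ Ω) (hKc : IsPreconnected Kᶜ) {f : ℂ → ℂ} (hf : DifferentiableOn ℂ f Ω) {ε : ℝ}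
    (hε : 0 < ε) : ∃ p : Polynomial ℂ, ∀ z ∈ K, ‖f z - p.eval z‖ < ε := by
  haveI : CompactSpace K := isCompact_iff_compactSpace.mp hK
  set g : C(K, ℂ) := ⟨fun z ↦ f z, ((hf.continuousOn).mono hKΩ).restrict⟩ with hgdef
  have hgA := restrict_mem_polynomialFunctions_topologicalClosure hΩ hKΩ hKc hf g fun z ↦ rfl
  have hgc : g ∈ closure (polynomialFunctions K : Set C(K, ℂ)) := hgA
  obtain ⟨q, hq, hdist⟩ := Metric.mem_closure_iff.1 hgc ε hε
  rw [polynomialFunctions_coe] at hq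
  obtain ⟨p, rfl⟩ := hq
  refine ⟨p, fun z hz ↦ ?_⟩
  have h := ContinuousMap.dist_apply_le_dist (f := g) (g := Polynomial.toContinuousMapOnAlgHom K p)
    ⟨z, hz⟩
  rw [dist_eq_norm] at h
  refine lt_of_le_of_lt ?_ (h.trans_lt hdist)
  simp [hgdef]

end Complex

end
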